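import Summits.Ventures.Crystal3D.Theorems.StickyWulffConstantTextureBuildCrustedCover
import Summits.Ventures.Crystal3D.Theorems.StickyWulffConstantTextureLiminfTexShadowAdhesionTDefs
import HarnessLib

/-!
# TB-1: the level-2 composition of `stub_textureBuild` with the adhesion hypothesis in T-FORM (v8.5 of record)
# (lane T, crux `TextureLiminfV5`, stmt-Ventures-23912; cf-p1 DECISION (cxxvii) «TB stubs/composition take T»)

HONEST FRAMING. Venture `Summits/Ventures/Crystal3D` (cell `crystal3d-full`), route `route-Ventures-StickyWulffConstant`, helper `--supports` the law-v5
crux `TextureLiminfV5` (stmt-Ventures-23912).  Pure logic over the landed interface (…TextureBuildCrustedCover, …TexShadowAdhesionTDefs); census-free,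
standard axioms; nothing atomistic is proved; rung F-C1 not moved.

* `shadowTheoremSatAtomicV5_of_crustedAdh` — `shadowTheoremSatAtomicV5_of_crusted` with the adhesion hypothesis an ARBITRARY `Adh : Prop` (the cover builder
  «TB-cover» consumes it, the composition only threads it).
* **`textureBuildT_of_stubs`** — THE v8.5 COMPOSITION: «TB-cover» (`BarlowResolution → BarlowAdhesionT → … ∃ crusted cover + mesh with small slack`) +
  «TB-energy» ⇒ `BarlowResolution → BarlowAdhesionT → BilayerWallV5 → PolytopeCalculus → BarlowFreeCertificate → ShadowTheoremSatV5` (through the atomic form and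
  `textureBuild_of_atomic`).
WHAT THIS IS NOT: no stub is proved; F-C1 not moved.
-/

noncomputable section

open scoped BigOperators InnerProductSpace ENNReal
open MeasureTheory

namespace Summit.Ventures.Crystal3D.Cruxes.TextureLiminf.TexShadow

open Summit.Ventures.Crystal3D Summit.Ventures.Crystal3D.Theorems Finset
open Literature.MathematicalPhysics.StatisticalMechanics (IsHaggSeq fccStacking barlowStacking contactDeficiency)

/-- **Level-2 composition over crusted cover + mesh, adhesion hypothesis arbitrary.** -/
theorem shadowTheoremSatAtomicV5_of_crustedAdh {Adh : Prop}
    (hcover : BarlowResolution → Adh →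
      ∀ C R₀ : ℝ, 1 ≤ R₀ → ∀ K δ θ : ℝ, 0 < δ → 0 < θ → ∃ N₀ : ℕ, ∀ N : ℕ, N₀ ≤ N → ∀ x : Fin N → E3, IsUnitPacking x →
        IsSaturated x → 6 * (N : ℝ) - (numContacts x : ℝ) ≤ K * (N : ℝ) ^ ((2 : ℝ) / 3) →
        ∃ (cc : CrustedCover C R₀ N x) (μ : Mesh cc.toCellCover δ),
          cc.tilingLoss₂ + cc.rimSum + μ.gapCost ≤ θ * (N : ℝ) ^ ((2 : ℝ) / 3))
    (henergy : PolytopeCalculus → BarlowFreeCertificate →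
      ∀ (C R₀ : ℝ) (N : ℕ) (x : Fin N → E3) (δ : ℝ) (cv : CellCover C R₀ N x) (μ : Mesh cv δ),
        ∃ (n : ℕ) (G : Fin n → Set E3) (A : Fin n → (E3 ≃ₗᵢ[ℝ] E3)) (c : Fin n → Fin n → ℝ) (m : Fin n → Fin n → E3),
          IsTexture (13 / 25) (1 / 2) n G A c m ∧ (1 - δ) * (N : ℝ) ≤ Real.sqrt 2 * vol n G ∧
          energy n G A c m ≤ cv.tentBudget + cv.chargeSum + μ.gapCost) :
    BarlowResolution → Adh → BilayerWallV5 → PolytopeCalculus → BarlowFreeCertificate → ShadowTheoremSatAtomicV5 := by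
  intro hres hadh hBW hpoly hfree _hG _hC _hNRG _hSL K δ θ hδ hθ
  obtain ⟨C, R₀, hR₀, hW⟩ := hBW
  obtain ⟨N₀, hN₀⟩ := hcover hres hadh C R₀ hR₀ K δ θ hδ hθ
  refine ⟨N₀, fun N hN x hx hsat hK => ?_⟩
  obtain ⟨cc, μ, hslack⟩ := hN₀ N hN x hx hsat hK
  obtain ⟨n, G, A, c, m, hT, hvol, hEn⟩ := henergy hpoly hfree C R₀ N x δ cc.toCellCover μ
  refine ⟨n, G, A, c, m, hT, hvol, ?_⟩
  have hdisc := cc.tentBudget_add_chargeSum_le₂ hR₀ hW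
  have htb : cc.toCellCover.tentBudget = cc.tentBudget := rfl
  have hcs : cc.toCellCover.chargeSum = cc.chargeSum := rfl
  rw [htb, hcs] at hEn
  linarith

/-- **THE v8.5 COMPOSITION OF RECORD**: TB-cover (T-form adhesion) + TB-energy ⇒ the registered shape of `stub_textureBuild` with `BarlowAdhesionT`. -/
theorem textureBuildT_of_stubs
    (hcover : BarlowResolution → BarlowAdhesionT →
      ∀ C R₀ : ℝ, 1 ≤ R₀ → ∀ K δ θ : ℝ, 0 < δ → 0 < θ → ∃ N₀ : ℕ, ∀ N : ℕ, N₀ ≤ N → ∀ x : Fin N → E3, IsUnitPacking x →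
        IsSaturated x → 6 * (N : ℝ) - (numContacts x : ℝ) ≤ K * (N : ℝ) ^ ((2 : ℝ) / 3) →
        ∃ (cc : CrustedCover C R₀ N x) (μ : Mesh cc.toCellCover δ),
          cc.tilingLoss₂ + cc.rimSum + μ.gapCost ≤ θ * (N : ℝ) ^ ((2 : ℝ) / 3))
    (henergy : PolytopeCalculus → BarlowFreeCertificate →
      ∀ (C R₀ : ℝ) (N : ℕ) (x : Fin N → E3) (δ : ℝ) (cv : CellCover C R₀ N x) (μ : Mesh cv δ),
        ∃ (n : ℕ) (G : Fin n → Set E3) (A : Fin n → (E3 ≃ₗᵢ[ℝ] E3)) (c : Fin n → Fin n → ℝ) (m : Fin n → Fin n → E3),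
          IsTexture (13 / 25) (1 / 2) n G A c m ∧ (1 - δ) * (N : ℝ) ≤ Real.sqrt 2 * vol n G ∧
          energy n G A c m ≤ cv.tentBudget + cv.chargeSum + μ.gapCost) :
    BarlowResolution → BarlowAdhesionT → BilayerWallV5 → PolytopeCalculus → BarlowFreeCertificate → ShadowTheoremSatV5 :=
  textureBuild_of_atomic (shadowTheoremSatAtomicV5_of_crustedAdh hcover henergy)

end Summit.Ventures.Crystal3D.Cruxes.TextureLiminf.TexShadow

end
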